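import Summits.ValiantsHypothesis.ValiantsHypothesis.Theorems.GeneratorObstructionsPerGenDegreeSuperQPCollapsedPermanent

/-!
# Route GeneratorObstructions — K1 `PerGenDegreeSuperQP` (stmt-ValiantsHypothesis-11654),
# line `per-side-atoms`: DOUBLY COLLAPSED PERMANENTS `per_m(x_{ik} ↦ y_{a(i), b(k)})` are
# polystable (towards: every ray `j = r₁·r₂`, `r₁, r₂ ∣ m`, of `S(per_m)` is hit)

Twelfth support file of the line; generalises `…CollapsedPermanent` (the case `a = id`). For two
factorisations `m = r₁ t₁ = r₂ t₂` let `a : [m] → [r₁]` and `b : [m] → [r₂]` be the balanced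
labellings (`t₁`, resp. `t₂`, letters per label) and substitute `x_{ik} ↦ y_{a(i), b(k)}` in `per_m`:
the DOUBLY COLLAPSED PERMANENT
`Q = ∑_σ ∏_i y_{a(σ i), b(i)} = ∑_M N(M) y^M` (sum over the `r₁ × r₂` contingency tables `M` with
row sums `t₁·(r₂/…)`… — precisely `M_{us} = #{i : a(σ i) = u, b(i) = s}`), a form of degree `m` in
the `r₁ r₂` variables `y_{u,s}` (`biCollapsedPer_eq_sum`, `coeff_biCollapsedPer`,
`mem_support_biCollapsedPer_iff`). Special cases: `r₁ = r₂ = m`: `per_m`; `r₂ = 1`: `m!/…`-multiple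
of the balanced monomial `(∏_u y_u)^{t₁}` of `…BalancedMonomialRays`; `r₁ = m`: the column-collapsed
permanent of `…CollapsedPermanent`.

**`Q` is POLYSTABLE** (`isPolystable_biCollapsedPer`), by BI 2017 Prop. 2.8 in the corrected
relative-interior form proved in the tree (`isPolystable_of_separating_diagonalStabilizers`): the
two label tori (`∏_u α_u^{t₁} = 1`, `∏_s β_s^{t₂} = 1`) fix `Q` and separate all variables
(`biCollapsedPer_separating`), and `(1,…,1)` is the positive combination
`∑_σ e_σ /(t₁ t₂ · #{σ : σ i₀ = i₀})` of the exponents (`biCollapsedPer_posCone`: the variable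
`y_{u,s}` has total exponent `#{(σ,i) : a(σ i) = u, b(i) = s} = t₂ · t₁ · (m-1)!` uniformly).
The companion `…BiCollapsedPermanentRays` places `Q` inside `Δ(per_m)` and concludes with the ray
criterion that EVERY ray `j = r₁ r₂` (`r₁, r₂ ∣ m`) of `S(per_m)` is hit and starts with an atom.

Honest framing: unconditional structure theorems (polystable degenerations of the permanent);
`stub_atomLate` (`c ≥ 2`), K1 and `GenFlipThesis` remain OPEN; nothing here bears on VP versus
VNP. References: [BurgisserIkenmeyer2017] Prop. 2.8 (corrected, tree erratum A31), Cor. 2.9;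
[MulmuleySohoni2001] §4.
-/

set_option linter.dupNamespace false

noncomputable section

namespace Summit.ValiantsHypothesis.ValiantsHypothesis.Theorems.GeneratorObstructions.PerGenDegreeSuperQP

open MvPolynomial
open Literature.NumberTheory.DiophantineGeometry Literature.Computability.AlgebraicComplexity
  Literature.Computability.Complexity

/-! ### 1. The second balanced labelling, read through `Fin.cast` -/

section Counting

variable {r₁ t₁ r₂ t₂ : ℕ}

/-- Product over `Fin (r₁ t₁)` of a function of the second balanced label
`b(i) = (cast i) / t₂` (`r₁ t₁ = r₂ t₂`) is the `t₂`-th power of the product over the labels.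
[folklore] -/
theorem prod_comp_castLabel (h : r₁ * t₁ = r₂ * t₂) {M : Type*} [CommMonoid M] (g : Fin r₂ → M) :
    ∏ i : Fin (r₁ * t₁), g (finProdFinEquiv.symm (Fin.cast h i)).1 = (∏ s : Fin r₂, g s) ^ t₂ := by
  rw [← prod_comp_colLabel (a := t₂) g]
  exact Fintype.prod_equiv (finCongr h) _ (fun k => g (finProdFinEquiv.symm k).1) (fun _ => rfl)

/-- Additive form of `prod_comp_castLabel`. [folklore] -/
theorem sum_comp_castLabel (h : r₁ * t₁ = r₂ * t₂) {M : Type*} [AddCommMonoid M] (g : Fin r₂ → M) :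
    ∑ i : Fin (r₁ * t₁), g (finProdFinEquiv.symm (Fin.cast h i)).1 = t₂ • ∑ s : Fin r₂, g s := by
  rw [← sum_comp_colLabel (a := t₂) g]
  exact Fintype.sum_equiv (finCongr h) _ (fun k => g (finProdFinEquiv.symm k).1) (fun _ => rfl)

/-- Every fibre of the second balanced labelling has exactly `t₂` elements. [folklore] -/
theorem card_filter_castLabel_eq (h : r₁ * t₁ = r₂ * t₂) (s : Fin r₂) :
    (Finset.univ.filter fun i : Fin (r₁ * t₁) => (finProdFinEquiv.symm (Fin.cast h i)).1 = s).card = t₂ := by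
  classical
  have h' := sum_comp_castLabel h (fun u : Fin r₂ => if u = s then (1 : ℕ) else 0)
  simp only [Finset.sum_boole, smul_eq_mul, Finset.filter_eq', Finset.mem_univ, if_true,
    Finset.card_singleton, mul_one, Nat.cast_id] at h'
  exact h'

/-- The number of permutations `σ` of `Fin (r₁ t₁)` with `a(σ i) = u` (`a` the first balanced
labelling) is `t₁ · #{σ : σ i₀ = i₀}`, for every `i, u`. [folklore] -/
theorem card_filter_perm_label_eq (i i₀ : Fin (r₁ * t₁)) (u : Fin r₁) :
    (Finset.univ.filter fun σ : Equiv.Perm (Fin (r₁ * t₁)) => (finProdFinEquiv.symm (σ i)).1 = u).card =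
      t₁ * (Finset.univ.filter fun σ : Equiv.Perm (Fin (r₁ * t₁)) => σ i₀ = i₀).card := by
  classical
  rw [Finset.card_eq_sum_card_fiberwise (f := fun σ : Equiv.Perm (Fin (r₁ * t₁)) => σ i)
    (t := Finset.univ.filter fun l : Fin (r₁ * t₁) => (finProdFinEquiv.symm l).1 = u)
    (fun σ hσ => by simpa using hσ)]
  have hfib : ∀ l ∈ (Finset.univ.filter fun l : Fin (r₁ * t₁) => (finProdFinEquiv.symm l).1 = u),
      ((Finset.univ.filter fun σ : Equiv.Perm (Fin (r₁ * t₁)) =>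
          (finProdFinEquiv.symm (σ i)).1 = u).filter fun σ => σ i = l).card =
        (Finset.univ.filter fun σ : Equiv.Perm (Fin (r₁ * t₁)) => σ i₀ = i₀).card := by
    intro l hl
    rw [Finset.mem_filter] at hl
    rw [← card_filter_perm_apply_eq i l i₀ i₀, Finset.filter_filter]
    congr 1
    ext σ
    simp only [Finset.mem_filter, Finset.mem_univ, true_and]
    exact ⟨fun hσ => hσ.2, fun hσ => ⟨by rw [hσ]; exact hl.2, hσ⟩⟩
  rw [Finset.sum_congr rfl hfib, Finset.sum_const, smul_eq_mul, card_filter_colLabel_eq]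

end Counting

/-! ### 2. The doubly collapsed permanent on `r₁ r₂` variables -/

section BiCollapsed

variable {r₁ t₁ r₂ t₂ : ℕ}

/-- **The doubly collapsed permanent as a sum over permutations**:
`Q = ∑_σ ∏_i y_{a(σ i), b(i)}`. [folklore] -/
theorem biCollapsedPer_eq_sum (h : r₁ * t₁ = r₂ * t₂) :
    MvPolynomial.rename
        (fun ik : Fin (r₁ * t₁) × Fin (r₁ * t₁) =>
          (finProdFinEquiv ((finProdFinEquiv.symm ik.1).1,
            (finProdFinEquiv.symm (Fin.cast h ik.2)).1) : Fin (r₁ * r₂)))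
        (perPoly (Fin (r₁ * t₁)) ℂ) =
      ∑ σ : Equiv.Perm (Fin (r₁ * t₁)), ∏ i : Fin (r₁ * t₁),
        X (finProdFinEquiv ((finProdFinEquiv.symm (σ i)).1,
          (finProdFinEquiv.symm (Fin.cast h i)).1) : Fin (r₁ * r₂)) := by
  rw [perPoly_eq_sum_prod, map_sum]
  simp only [map_prod, rename_X]

/-- The `σ`-th product of variables of `Q` is the monomial with exponent
`e_σ = ∑_i ε_{(a(σ i), b i)}`. [folklore] -/
theorem prod_X_eq_monomial_sum_single_bi (h : r₁ * t₁ = r₂ * t₂) (σ : Equiv.Perm (Fin (r₁ * t₁))) :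
    (∏ i : Fin (r₁ * t₁), X (finProdFinEquiv ((finProdFinEquiv.symm (σ i)).1,
        (finProdFinEquiv.symm (Fin.cast h i)).1) : Fin (r₁ * r₂)) : MvPolynomial (Fin (r₁ * r₂)) ℂ) =
      monomial (∑ i : Fin (r₁ * t₁), Finsupp.single (finProdFinEquiv ((finProdFinEquiv.symm (σ i)).1,
        (finProdFinEquiv.symm (Fin.cast h i)).1) : Fin (r₁ * r₂)) 1) 1 := by
  rw [monomial_sum_one]
  rfl

/-- **Coefficients of `Q` count permutations.** [folklore] -/
theorem coeff_biCollapsedPer (h : r₁ * t₁ = r₂ * t₂) (α : Fin (r₁ * r₂) →₀ ℕ) :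
    coeff α (MvPolynomial.rename
        (fun ik : Fin (r₁ * t₁) × Fin (r₁ * t₁) =>
          (finProdFinEquiv ((finProdFinEquiv.symm ik.1).1,
            (finProdFinEquiv.symm (Fin.cast h ik.2)).1) : Fin (r₁ * r₂)))
        (perPoly (Fin (r₁ * t₁)) ℂ)) =
      ((Finset.univ.filter fun σ : Equiv.Perm (Fin (r₁ * t₁)) =>
        (∑ i : Fin (r₁ * t₁), Finsupp.single (finProdFinEquiv ((finProdFinEquiv.symm (σ i)).1,
          (finProdFinEquiv.symm (Fin.cast h i)).1) : Fin (r₁ * r₂)) 1) = α).card : ℂ) := by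
  classical
  rw [biCollapsedPer_eq_sum h, coeff_sum]
  simp only [prod_X_eq_monomial_sum_single_bi h, coeff_monomial, Finset.sum_boole]

/-- The support of `Q` is the set of exponents `e_σ`. [folklore] -/
theorem mem_support_biCollapsedPer_iff (h : r₁ * t₁ = r₂ * t₂) (α : Fin (r₁ * r₂) →₀ ℕ) :
    α ∈ (MvPolynomial.rename
        (fun ik : Fin (r₁ * t₁) × Fin (r₁ * t₁) =>
          (finProdFinEquiv ((finProdFinEquiv.symm ik.1).1,
            (finProdFinEquiv.symm (Fin.cast h ik.2)).1) : Fin (r₁ * r₂)))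
        (perPoly (Fin (r₁ * t₁)) ℂ)).support ↔
      ∃ σ : Equiv.Perm (Fin (r₁ * t₁)),
        (∑ i : Fin (r₁ * t₁), Finsupp.single (finProdFinEquiv ((finProdFinEquiv.symm (σ i)).1,
          (finProdFinEquiv.symm (Fin.cast h i)).1) : Fin (r₁ * r₂)) 1) = α := by
  classical
  rw [mem_support_iff, coeff_biCollapsedPer h, Nat.cast_ne_zero, ← Nat.pos_iff_ne_zero,
    Finset.card_pos, Finset.filter_nonempty_iff]
  simp

/-- `Q` is a form of degree `m = r₁ t₁`. [folklore] -/
theorem biCollapsedPer_isHomogeneous (h : r₁ * t₁ = r₂ * t₂) :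
    (MvPolynomial.rename
        (fun ik : Fin (r₁ * t₁) × Fin (r₁ * t₁) =>
          (finProdFinEquiv ((finProdFinEquiv.symm ik.1).1,
            (finProdFinEquiv.symm (Fin.cast h ik.2)).1) : Fin (r₁ * r₂)))
        (perPoly (Fin (r₁ * t₁)) ℂ)).IsHomogeneous (r₁ * t₁) := by
  simpa [Fintype.card_fin] using
    (perPoly_isHomogeneous (n := Fin (r₁ * t₁)) (k := ℂ)).rename_isHomogeneous
      (f := fun ik : Fin (r₁ * t₁) × Fin (r₁ * t₁) =>
        (finProdFinEquiv ((finProdFinEquiv.symm ik.1).1,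
          (finProdFinEquiv.symm (Fin.cast h ik.2)).1) : Fin (r₁ * r₂)))

/-- `Q ≠ 0`. [folklore] -/
theorem biCollapsedPer_ne_zero (h : r₁ * t₁ = r₂ * t₂) :
    MvPolynomial.rename
        (fun ik : Fin (r₁ * t₁) × Fin (r₁ * t₁) =>
          (finProdFinEquiv ((finProdFinEquiv.symm ik.1).1,
            (finProdFinEquiv.symm (Fin.cast h ik.2)).1) : Fin (r₁ * r₂)))
        (perPoly (Fin (r₁ * t₁)) ℂ) ≠ 0 := by
  intro h0
  have hmem := (mem_support_biCollapsedPer_iff h _).mpr ⟨1, rfl⟩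
  rw [h0, support_zero] at hmem
  exact absurd hmem (Finset.notMem_empty _)

/-- Diagonal substitutions with `∏_i d(a(σ i), b i) = 1` for all `σ` fix `Q`. [folklore] -/
theorem linSubst_diagonal_biCollapsedPer_eq (h : r₁ * t₁ = r₂ * t₂) (d : Fin (r₁ * r₂) → ℂ)
    (hd : ∀ σ : Equiv.Perm (Fin (r₁ * t₁)),
      ∏ i : Fin (r₁ * t₁), d (finProdFinEquiv ((finProdFinEquiv.symm (σ i)).1,
        (finProdFinEquiv.symm (Fin.cast h i)).1)) = 1) :
    linSubst (Fin (r₁ * r₂)) ℂ (Matrix.diagonal d)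
        (MvPolynomial.rename
          (fun ik : Fin (r₁ * t₁) × Fin (r₁ * t₁) =>
            (finProdFinEquiv ((finProdFinEquiv.symm ik.1).1,
              (finProdFinEquiv.symm (Fin.cast h ik.2)).1) : Fin (r₁ * r₂)))
          (perPoly (Fin (r₁ * t₁)) ℂ)) =
      MvPolynomial.rename
        (fun ik : Fin (r₁ * t₁) × Fin (r₁ * t₁) =>
          (finProdFinEquiv ((finProdFinEquiv.symm ik.1).1,
            (finProdFinEquiv.symm (Fin.cast h ik.2)).1) : Fin (r₁ * r₂)))
        (perPoly (Fin (r₁ * t₁)) ℂ) := by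
  classical
  rw [biCollapsedPer_eq_sum h, map_sum]
  refine Finset.sum_congr rfl fun σ _ => ?_
  rw [prod_X_eq_monomial_sum_single_bi h, linSubst_diagonal_monomial]
  have hprod : ((∑ i : Fin (r₁ * t₁), Finsupp.single (finProdFinEquiv ((finProdFinEquiv.symm (σ i)).1,
      (finProdFinEquiv.symm (Fin.cast h i)).1) : Fin (r₁ * r₂)) 1).prod fun x n => d x ^ n) = 1 := by
    rw [← hd σ, ← Finsupp.prod_finsetSum_index (fun _ => pow_zero _) (fun _ _ _ => pow_add _ _ _)]
    refine Finset.prod_congr rfl fun i _ => ?_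
    rw [Finsupp.prod_single_index (h := fun x n => d x ^ n) (pow_zero _), pow_one]
  rw [hprod, one_smul]

end BiCollapsed

/-! ### 3. Polystability of the doubly collapsed permanent -/

section Polystable

variable {r₁ t₁ r₂ t₂ : ℕ}

/-- **Separating diagonal stabilizers**: two variables `y_{u,s} ≠ y_{u',s'}` are separated by a
label-`a` scaling (`u ≠ u'`; each monomial uses every `a`-label `t₁` times) or a label-`b` scaling
(`s ≠ s'`; every `b`-label `t₂` times) fixing `Q`. [cite: BurgisserIkenmeyer2017, Prop. 2.8 and Cor. 2.9 (proof)] -/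
theorem biCollapsedPer_separating (h : r₁ * t₁ = r₂ * t₂) (x x' : Fin (r₁ * r₂)) (hxx : x ≠ x') :
    ∃ d : Fin (r₁ * r₂) → ℂ,
      linSubst (Fin (r₁ * r₂)) ℂ (Matrix.diagonal d)
          (MvPolynomial.rename
            (fun ik : Fin (r₁ * t₁) × Fin (r₁ * t₁) =>
              (finProdFinEquiv ((finProdFinEquiv.symm ik.1).1,
                (finProdFinEquiv.symm (Fin.cast h ik.2)).1) : Fin (r₁ * r₂)))
            (perPoly (Fin (r₁ * t₁)) ℂ)) =
        MvPolynomial.rename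
          (fun ik : Fin (r₁ * t₁) × Fin (r₁ * t₁) =>
            (finProdFinEquiv ((finProdFinEquiv.symm ik.1).1,
              (finProdFinEquiv.symm (Fin.cast h ik.2)).1) : Fin (r₁ * r₂)))
          (perPoly (Fin (r₁ * t₁)) ℂ) ∧
      d x ≠ d x' := by
  classical
  obtain ⟨⟨u, s⟩, rfl⟩ := finProdFinEquiv.surjective x
  obtain ⟨⟨u', s'⟩, rfl⟩ := finProdFinEquiv.surjective x'
  by_cases hu : u = u'
  · subst hu
    have hs : s ≠ s' := fun h' => hxx (by rw [h'])
    refine ⟨fun y => if (finProdFinEquiv.symm y).2 = s then 2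
        else if (finProdFinEquiv.symm y).2 = s' then 1 / 2 else 1, ?_, ?_⟩
    · apply linSubst_diagonal_biCollapsedPer_eq
      intro σ
      simp only [Equiv.symm_apply_apply]
      rw [prod_comp_castLabel h
        (fun v : Fin r₂ => if v = s then (2 : ℂ) else if v = s' then 1 / 2 else 1),
        prod_ite_ite_eq_one hs, one_pow]
    · simp only [Equiv.symm_apply_apply, if_neg hs.symm]
      norm_num
  · refine ⟨fun y => if (finProdFinEquiv.symm y).1 = u then 2
        else if (finProdFinEquiv.symm y).1 = u' then 1 / 2 else 1, ?_, ?_⟩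
    · apply linSubst_diagonal_biCollapsedPer_eq
      intro σ
      simp only [Equiv.symm_apply_apply]
      rw [Equiv.prod_comp σ (fun l : Fin (r₁ * t₁) => if (finProdFinEquiv.symm l).1 = u then (2 : ℂ)
        else if (finProdFinEquiv.symm l).1 = u' then 1 / 2 else 1)]
      rw [prod_comp_colLabel (a := t₁)
        (fun v : Fin r₁ => if v = u then (2 : ℂ) else if v = u' then 1 / 2 else 1),
        prod_ite_ite_eq_one hu, one_pow]
    · simp only [Equiv.symm_apply_apply, if_neg (Ne.symm hu)]
      norm_num

/-- **Positive cone condition**: `(1,…,1) = ∑_σ e_σ / (t₂ t₁ #{σ : σ i₀ = i₀})`, all coefficients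
positive on the support. [cite: BurgisserIkenmeyer2017, Prop. 2.8 and Cor. 2.9 (proof)] -/
theorem biCollapsedPer_posCone (h : r₁ * t₁ = r₂ * t₂) (hr₁ : 0 < r₁) (ht₁ : 0 < t₁) (ht₂ : 0 < t₂) :
    ∃ c : (Fin (r₁ * r₂) →₀ ℕ) → ℚ,
      (∀ α ∈ (MvPolynomial.rename
          (fun ik : Fin (r₁ * t₁) × Fin (r₁ * t₁) =>
            (finProdFinEquiv ((finProdFinEquiv.symm ik.1).1,
              (finProdFinEquiv.symm (Fin.cast h ik.2)).1) : Fin (r₁ * r₂)))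
          (perPoly (Fin (r₁ * t₁)) ℂ)).support, 0 < c α) ∧
      ∀ x : Fin (r₁ * r₂), ∑ α ∈ (MvPolynomial.rename
          (fun ik : Fin (r₁ * t₁) × Fin (r₁ * t₁) =>
            (finProdFinEquiv ((finProdFinEquiv.symm ik.1).1,
              (finProdFinEquiv.symm (Fin.cast h ik.2)).1) : Fin (r₁ * r₂)))
          (perPoly (Fin (r₁ * t₁)) ℂ)).support, c α * (α x : ℚ) = 1 := by
  classical
  have hm : 0 < r₁ * t₁ := Nat.mul_pos hr₁ ht₁
  set i₀ : Fin (r₁ * t₁) := ⟨0, hm⟩ with hi₀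
  set S : ℕ := (Finset.univ.filter fun σ : Equiv.Perm (Fin (r₁ * t₁)) => σ i₀ = i₀).card with hSdef
  have hS : 0 < S := Finset.card_pos.mpr ⟨1, by simp⟩
  set e : Equiv.Perm (Fin (r₁ * t₁)) → (Fin (r₁ * r₂) →₀ ℕ) := fun σ =>
    ∑ i : Fin (r₁ * t₁), Finsupp.single (finProdFinEquiv ((finProdFinEquiv.symm (σ i)).1,
      (finProdFinEquiv.symm (Fin.cast h i)).1) : Fin (r₁ * r₂)) 1 with hedef
  set N : (Fin (r₁ * r₂) →₀ ℕ) → ℕ := fun α =>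
    (Finset.univ.filter fun σ : Equiv.Perm (Fin (r₁ * t₁)) => e σ = α).card with hNdef
  set P := MvPolynomial.rename
          (fun ik : Fin (r₁ * t₁) × Fin (r₁ * t₁) =>
            (finProdFinEquiv ((finProdFinEquiv.symm ik.1).1,
              (finProdFinEquiv.symm (Fin.cast h ik.2)).1) : Fin (r₁ * r₂)))
          (perPoly (Fin (r₁ * t₁)) ℂ) with hPdef
  have hsupp : ∀ α, α ∈ P.support ↔ ∃ σ, e σ = α := fun α => mem_support_biCollapsedPer_iff h α
  refine ⟨fun α => (N α : ℚ) / ((t₂ * (t₁ * S) : ℕ) : ℚ), ?_, ?_⟩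
  · intro α hα
    obtain ⟨σ, hσ⟩ := (hsupp α).mp hα
    have hN : 0 < N α := Finset.card_pos.mpr ⟨σ, by simp [hσ]⟩
    have hK : 0 < t₂ * (t₁ * S) := Nat.mul_pos ht₂ (Nat.mul_pos ht₁ hS)
    positivity
  · intro x
    obtain ⟨⟨u, s⟩, rfl⟩ := finProdFinEquiv.surjective x
    have hmaps : ∀ σ ∈ (Finset.univ : Finset (Equiv.Perm (Fin (r₁ * t₁)))), e σ ∈ P.support :=
      fun σ _ => (hsupp _).mpr ⟨σ, rfl⟩
    have key : ∑ α ∈ P.support, (N α : ℚ) * (α (finProdFinEquiv (u, s)) : ℚ) =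
        ∑ σ : Equiv.Perm (Fin (r₁ * t₁)), ((e σ) (finProdFinEquiv (u, s)) : ℚ) := by
      rw [← Finset.sum_fiberwise_of_maps_to hmaps]
      refine Finset.sum_congr rfl fun α _ => ?_
      rw [Finset.sum_congr rfl fun σ hσ => by rw [(Finset.mem_filter.mp hσ).2], Finset.sum_const,
        nsmul_eq_mul]
    have h1 : ∀ σ : Equiv.Perm (Fin (r₁ * t₁)), (e σ) (finProdFinEquiv (u, s)) =
        ∑ i : Fin (r₁ * t₁), if (finProdFinEquiv.symm (σ i)).1 = u ∧
          (finProdFinEquiv.symm (Fin.cast h i)).1 = s then 1 else 0 := by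
      intro σ
      simp only [hedef, Finsupp.coe_finsetSum, Finset.sum_apply, Finsupp.single_apply,
        EmbeddingLike.apply_eq_iff_eq, Prod.mk.injEq]
    have h2 : ∀ i : Fin (r₁ * t₁),
        (Finset.univ.filter fun σ : Equiv.Perm (Fin (r₁ * t₁)) =>
          (finProdFinEquiv.symm (σ i)).1 = u ∧ (finProdFinEquiv.symm (Fin.cast h i)).1 = s).card =
        if (finProdFinEquiv.symm (Fin.cast h i)).1 = s then t₁ * S else 0 := by
      intro i
      split_ifs with hi
      · rw [hSdef, ← card_filter_perm_label_eq i i₀ u]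
        congr 1
        ext σ
        simp only [Finset.mem_filter, Finset.mem_univ, true_and]
        exact ⟨fun hσ => hσ.1, fun hσ => ⟨hσ, hi⟩⟩
      · rw [Finset.card_eq_zero, Finset.filter_eq_empty_iff]
        intro σ _ hσ
        exact hi hσ.2
    have count : ∑ σ : Equiv.Perm (Fin (r₁ * t₁)), ((e σ) (finProdFinEquiv (u, s)) : ℚ) =
        ((t₂ * (t₁ * S) : ℕ) : ℚ) := by
      rw [← Nat.cast_sum]
      congr 1
      simp_rw [h1]
      rw [Finset.sum_comm]
      simp_rw [Finset.sum_boole, Nat.cast_id, h2]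
      rw [Finset.sum_ite, Finset.sum_const_zero, add_zero, Finset.sum_const, smul_eq_mul,
        card_filter_castLabel_eq h]
    have hK : ((t₂ * (t₁ * S) : ℕ) : ℚ) ≠ 0 := by
      have : 0 < t₂ * (t₁ * S) := Nat.mul_pos ht₂ (Nat.mul_pos ht₁ hS)
      exact_mod_cast this.ne'
    simp_rw [div_mul_eq_mul_div, ← Finset.sum_div, key, count]
    exact div_self hK

/-- **The doubly collapsed permanent is polystable** (`m = r₁ t₁ = r₂ t₂`, all `≥ 1`).
[cite: BurgisserIkenmeyer2017, Prop. 2.8 and Cor. 2.9] -/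
theorem isPolystable_biCollapsedPer (h : r₁ * t₁ = r₂ * t₂) (hr₁ : 0 < r₁) (ht₁ : 0 < t₁)
    (ht₂ : 0 < t₂) :
    IsPolystable (MvPolynomial.rename
        (fun ik : Fin (r₁ * t₁) × Fin (r₁ * t₁) =>
          (finProdFinEquiv ((finProdFinEquiv.symm ik.1).1,
            (finProdFinEquiv.symm (Fin.cast h ik.2)).1) : Fin (r₁ * r₂)))
        (perPoly (Fin (r₁ * t₁)) ℂ)) := by
  obtain ⟨c, hcpos, hc⟩ := biCollapsedPer_posCone h hr₁ ht₁ ht₂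
  exact isPolystable_of_separating_diagonalStabilizers _ (biCollapsedPer_isHomogeneous h)
    (fun x x' hxx => biCollapsedPer_separating h x x' hxx) c hcpos hc

end Polystable

end Summit.ValiantsHypothesis.ValiantsHypothesis.Theorems.GeneratorObstructions.PerGenDegreeSuperQP

end
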